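import Literature.AlgebraicGeometry.Modules.PullbackTensor
import Literature.AlgebraicGeometry.Modules.TensorAssociator
import Literature.AlgebraicGeometry.Modules.SkyscraperModule
import HarnessLib

/-!
# Stalks of the tensor product of `𝒪_X`-modules, I: the stalk of the presheaf tensor product and `TStalk → N_x ⊗ M_x`

The Stacks Project, Tag 01CA (Modules, Lemma 17.16.1), verbatim: "Let `(X, 𝒪_X)` be a ringed space. Let `𝓕`, `𝓖` be
`𝒪_X`-modules. Let `x ∈ X`. There is a canonical isomorphism of `𝒪_{X,x}`-modules `(𝓕 ⊗_{𝒪_X} 𝓖)_x = 𝓕_x ⊗_{𝒪_{X,x}} 𝓖_x`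
functorial in `𝓕` and `𝓖`." (Proof there: the presheaf tensor product has these stalks since tensor products commute with
filtered colimits, and sheafification does not change stalks.)

The tree's tensor product `Modules.tensorObj N M` (`Modules/TensorProduct`) is the sheafification of the presheaf
`U ↦ N(U) ⊗_{𝒪_X(U)} M(U)` (`tensorPresheaf N M`, unit `tensorUnitHom`), and the tree's stalk functor is
`Modules.stalkFunctor x : X.Modules ⥤ ModuleCat 𝒪_{X,x}` (`Modules/SkyscraperModule`). This file (part I of two) sets up the stalk
`TStalk N M x` of the PRESHEAF tensor product with its `𝒪_{X,x}`-module structure (Mathlib `ModuleCat/Stalk`), proves an induction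
principle on it, and constructs the `𝒪_{X,x}`-LINEAR comparison **`toTensor N M x : TStalk N M x →ₗ N_x ⊗_{𝒪_{X,x}} M_x`,
`germ_U(n ⊗ m) ↦ germ_U n ⊗ germ_U m`** (`colimit.desc` of `TensorProduct.liftAddHom` cocone components), together with the germs
`tgermPair n m = germ_{U ∩ V}(n| ⊗ m|)` and their bilinearity lemmas used by part II (`Modules/TensorStalk`) to invert it.
Everything is proved; 0 named facts; the only instance is the module structure on the presheaf stalk (Mathlib's, retyped).

Use (cell `pub-hodge-ring2`, crux 26512, 0-fact lane [BOX-RES]); library only.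

## References

* The Stacks Project, Tag 01CA (Modules, Lemma 17.16.1: stalks of the tensor product). [StacksProject]
* U. Görtz, T. Wedhorn, *Algebraic Geometry I* (2nd ed. 2020), (7.4.7), Prop. 7.17 (`(𝓕 ⊗ 𝓖)_x = 𝓕_x ⊗ 𝓖_x`). [GortzWedhorn2020]
-/

noncomputable section

-- `TopCat.Presheaf`/`Scheme.Modules` are not reducible (as in Mathlib's `AlgebraicGeometry/Modules/Sheaf.lean`).
set_option backward.isDefEq.respectTransparency false

open CategoryTheory CategoryTheory.Limits AlgebraicGeometry Opposite TopologicalSpace MonoidalCategory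
open scoped TensorProduct

universe u

namespace Literature.AlgebraicGeometry.Modules

variable {X : Scheme.{u}} (N M : X.Modules) (x : X)

/-! ### §1 The stalk of the presheaf tensor product and `TStalk N M x ≃ N_x ⊗ M_x` -/

section PresheafStalk

/-- The presheaf tensor product `U ↦ N(U) ⊗_{𝒪_X(U)} M(U)`, retyped over `X.presheaf ⋙ forget₂` (definitionally `tensorPresheaf N M`;
in this form Mathlib's `ModuleCat/Stalk` endows its stalks with their `𝒪_{X,x}`-module structure). [cite: StacksProject, Tag 01CA] -/
abbrev tensorPresheafC : PresheafOfModules.{u} (X.presheaf ⋙ forget₂ CommRingCat RingCat) := tensorPresheaf N M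

/-- Its underlying presheaf of abelian groups. [cite: StacksProject, Tag 01CA] -/
abbrev tensorPresheafAb : TopCat.Presheaf Ab X.toTopCat := (tensorPresheafC N M).presheaf

/-- The stalk at `x` of the PRESHEAF tensor product `U ↦ N(U) ⊗_{𝒪_X(U)} M(U)` (an abelian group).
[cite: StacksProject, Tag 01CA (Lemma 17.16.1)] -/
abbrev TStalk : Type u := ↑((tensorPresheafAb N M).stalk x)

/-- The `𝒪_{X,x}`-module structure on the stalk of the presheaf tensor product (Mathlib `ModuleCat/Stalk`).
[cite: GortzWedhorn2020, (7.4.7)] -/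
instance tstalkModule : Module (X.presheaf.stalk x) (TStalk N M x) :=
  inferInstanceAs (Module (X.presheaf.stalk x) ↑(TopCat.Presheaf.stalk (tensorPresheafC N M).presheaf x))

/-- The germ at `x` of a section of the presheaf tensor product. [cite: StacksProject, Tag 01CA] -/
def tgerm (U : X.Opens) (hx : x ∈ U) (q : TSec N M U) : TStalk N M x :=
  (tensorPresheafAb N M).germ U x hx q

/-- Unfolding. [cite: StacksProject, Tag 01CA] -/
theorem tgerm_def (U : X.Opens) (hx : x ∈ U) (q : TSec N M U) : tgerm N M x U hx q = (tensorPresheafAb N M).germ U x hx q := rfl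

/-- `germ 0 = 0`. [cite: GortzWedhorn2020, (7.1) and (7.4.7)] -/
theorem tgerm_zero (U : X.Opens) (hx : x ∈ U) : tgerm N M x U hx 0 = 0 :=
  map_zero (ConcreteCategory.hom ((tensorPresheafAb N M).germ U x hx))

/-- `germ (a + b) = germ a + germ b`. [cite: GortzWedhorn2020, (7.1) and (7.4.7)] -/
theorem tgerm_add (U : X.Opens) (hx : x ∈ U) (a b : TSec N M U) :
    tgerm N M x U hx (a + b) = tgerm N M x U hx a + tgerm N M x U hx b :=
  map_add (ConcreteCategory.hom ((tensorPresheafAb N M).germ U x hx)) a b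

/-- `germ (r • q) = germ r • germ q` in the stalk of the presheaf tensor product. [cite: GortzWedhorn2020, (7.4.7)] -/
theorem tgerm_smul (U : X.Opens) (hx : x ∈ U) (r : secRing X U) (q : TSec N M U) :
    tgerm N M x U hx (r • q) = X.presheaf.germ U x hx r • tgerm N M x U hx q :=
  PresheafOfModules.germ_smul (tensorPresheafC N M) x U hx r q

/-- Germs of restrictions. [cite: StacksProject, Tag 01CA] -/
theorem tgerm_resT {U V : X.Opens} (hV : V ≤ U) (hx : x ∈ V) (q : TSec N M U) :
    tgerm N M x V hx (resT N M hV q) = tgerm N M x U (hV hx) q := by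
  rw [tgerm_def, tgerm_def, ← resT_eq]
  exact (tensorPresheafAb N M).germ_res_apply (homOfLE hV) x hx q

/-- Every element of the stalk of the presheaf tensor product is a germ. [cite: StacksProject, Tag 01CA] -/
theorem exists_tgerm_eq (t : TStalk N M x) : ∃ (U : X.Opens) (hx : x ∈ U) (q : TSec N M U), tgerm N M x U hx q = t :=
  (tensorPresheafAb N M).exists_germ_eq t

/-- **Induction on the stalk of the presheaf tensor product**: a property stable under `0` and `+` that holds for the germs
`germ_U(n ⊗ m)` of pure tensors holds everywhere. [cite: StacksProject, Tag 01CA] -/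
theorem tstalk_induction {P : TStalk N M x → Prop} (t : TStalk N M x)
    (tmul : ∀ (U : X.Opens) (hx : x ∈ U) (n : secMod N U) (m : secMod M U), P (tgerm N M x U hx (n ⊗ₜ m)))
    (zero : P 0) (add : ∀ a b, P a → P b → P (a + b)) : P t := by
  obtain ⟨U, hx, q, rfl⟩ := exists_tgerm_eq N M x t
  induction q using TensorProduct.induction_on with
  | zero => rw [tgerm_zero]; exact zero
  | tmul n m => exact tmul U hx n m
  | add a b ha hb => rw [tgerm_add]; exact add _ _ ha hb

/-- The stalk `N_x` as an `𝒪_{X,x}`-module (the tree's `stalkFunctor`). [cite: GortzWedhorn2020, (7.8.6)] -/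
abbrev MStalk (E : X.Modules) : Type u := (stalkFunctor x).obj E

/-- `germ 0 = 0` in `E_x`. [cite: GortzWedhorn2020, (7.1) and (7.4.7)] -/
theorem stalkGerm_zero (E : X.Modules) (U : X.Opens) (hx : x ∈ U) : stalkGerm x E U hx 0 = 0 :=
  map_zero (ConcreteCategory.hom (E.presheaf.germ U x hx))

/-- `germ (a + b) = germ a + germ b` in `E_x`. [cite: GortzWedhorn2020, (7.1) and (7.4.7)] -/
theorem stalkGerm_add (E : X.Modules) (U : X.Opens) (hx : x ∈ U) (a b : secMod E U) :
    stalkGerm x E U hx (a + b) = stalkGerm x E U hx a + stalkGerm x E U hx b :=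
  map_add (ConcreteCategory.hom (E.presheaf.germ U x hx)) a b

/-- `germ_V (s|_V) = germ_U s`. [cite: GortzWedhorn2020, (7.1) and (7.4.7)] -/
theorem stalkGerm_res (E : X.Modules) {U V : X.Opens} (hV : V ≤ U) (hx : x ∈ V) (s : secMod E U) :
    stalkGerm x E V hx (res E hV s) = stalkGerm x E U (hV hx) s :=
  E.presheaf.germ_res_apply (homOfLE hV) x hx s

/-- Restriction is semilinear: `(r • m)|_V = r|_V • m|_V`. [cite: StacksProject, Tag 01CA] -/
theorem res_smul (E : X.Modules) {U V : X.Opens} (hV : V ≤ U) (r : secRing X U) (m : secMod E U) :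
    res E hV (r • m) = resRing hV r • res E hV m :=
  (toCommRingedPresheaf E).map_smul (homOfLE hV).op r m

/-- `0|_V = 0`. [cite: GortzWedhorn2020, (7.1) and (7.4.7)] -/
theorem res_zero (E : X.Modules) {U V : X.Opens} (hV : V ≤ U) : res E hV 0 = 0 :=
  map_zero (ConcreteCategory.hom (E.presheaf.map (homOfLE hV).op))

/-- `(a + b)|_V = a|_V + b|_V`. [cite: GortzWedhorn2020, (7.1) and (7.4.7)] -/
theorem res_add (E : X.Modules) {U V : X.Opens} (hV : V ≤ U) (a b : secMod E U) : res E hV (a + b) = res E hV a + res E hV b :=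
  map_add (ConcreteCategory.hom (E.presheaf.map (homOfLE hV).op)) a b

/-- `0|_V = 0` for the presheaf tensor product. [cite: GortzWedhorn2020, (7.1) and (7.4.7)] -/
theorem resT_zero {U V : X.Opens} (hV : V ≤ U) : resT N M hV 0 = 0 :=
  map_zero ((tensorPresheaf N M).map (homOfLE hV).op).hom

/-- `(a + b)|_V = a|_V + b|_V` for the presheaf tensor product. [cite: GortzWedhorn2020, (7.1) and (7.4.7)] -/
theorem resT_add {U V : X.Opens} (hV : V ≤ U) (a b : TSec N M U) : resT N M hV (a + b) = resT N M hV a + resT N M hV b :=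
  map_add ((tensorPresheaf N M).map (homOfLE hV).op).hom a b

/-- `germ_U n ⊗ germ_U m` depends additively and `𝒪_X(U)`-balancedly on `(n, m)`: the component at `U` of the cocone defining
`TStalk → N_x ⊗ M_x`. [cite: StacksProject, Tag 01CA (Lemma 17.16.1)] -/
def toTensorCoconeApp (U : X.Opens) (hx : x ∈ U) : TSec N M U →+ MStalk x N ⊗[X.presheaf.stalk x] MStalk x M :=
  TensorProduct.liftAddHom
    { toFun := fun n =>
        { toFun := fun m => stalkGerm x N U hx n ⊗ₜ[X.presheaf.stalk x] stalkGerm x M U hx m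
          map_zero' := by rw [stalkGerm_zero, TensorProduct.tmul_zero]
          map_add' := fun m m' => by rw [stalkGerm_add, TensorProduct.tmul_add] }
      map_zero' := by
        ext m
        change stalkGerm x N U hx 0 ⊗ₜ[X.presheaf.stalk x] stalkGerm x M U hx m = 0
        rw [stalkGerm_zero, TensorProduct.zero_tmul]
      map_add' := fun n n' => by
        ext m
        change stalkGerm x N U hx (n + n') ⊗ₜ[X.presheaf.stalk x] stalkGerm x M U hx m =
          stalkGerm x N U hx n ⊗ₜ[X.presheaf.stalk x] stalkGerm x M U hx m + stalkGerm x N U hx n' ⊗ₜ[X.presheaf.stalk x] stalkGerm x M U hx m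
        rw [stalkGerm_add, TensorProduct.add_tmul] }
    (fun r n m => by
      change stalkGerm x N U hx (r • n) ⊗ₜ[X.presheaf.stalk x] stalkGerm x M U hx m =
        stalkGerm x N U hx n ⊗ₜ[X.presheaf.stalk x] stalkGerm x M U hx (r • m)
      change N.presheaf.germ U x hx (r • n) ⊗ₜ[X.presheaf.stalk x] stalkGerm x M U hx m =
        stalkGerm x N U hx n ⊗ₜ[X.presheaf.stalk x] M.presheaf.germ U x hx (r • m)
      rw [germ_smul, germ_smul]
      exact TensorProduct.smul_tmul _ _ _)

/-- Value on pure tensors. [cite: StacksProject, Tag 01CA] -/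
theorem toTensorCoconeApp_tmul (U : X.Opens) (hx : x ∈ U) (n : secMod N U) (m : secMod M U) :
    toTensorCoconeApp N M x U hx (n ⊗ₜ m) = stalkGerm x N U hx n ⊗ₜ[X.presheaf.stalk x] stalkGerm x M U hx m :=
  TensorProduct.liftAddHom_tmul _ _ n m

/-- Compatibility of the cocone components with restriction. [cite: StacksProject, Tag 01CA] -/
theorem toTensorCoconeApp_resT {U V : X.Opens} (hV : V ≤ U) (hxV : x ∈ V) (q : TSec N M U) :
    toTensorCoconeApp N M x V hxV (resT N M hV q) = toTensorCoconeApp N M x U (hV hxV) q := by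
  induction q using TensorProduct.induction_on with
  | zero => rw [resT_zero, map_zero, map_zero]
  | tmul n m => rw [resT_tmul, toTensorCoconeApp_tmul, toTensorCoconeApp_tmul, stalkGerm_res, stalkGerm_res]
  | add a b ha hb => rw [resT_add, map_add, ha, hb, map_add]

/-- The cocone over the neighbourhood system of `x`: `N(U) ⊗ M(U) → N_x ⊗ M_x`. [cite: StacksProject, Tag 01CA (Lemma 17.16.1)] -/
def toTensorCocone : Cocone ((OpenNhds.inclusion x).op ⋙ tensorPresheafAb N M) where
  pt := AddCommGrpCat.of (MStalk x N ⊗[X.presheaf.stalk x] MStalk x M)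
  ι :=
    { app := fun U => AddCommGrpCat.ofHom (toTensorCoconeApp N M x U.unop.1 U.unop.2)
      naturality := fun U V i => by
        ext q
        exact toTensorCoconeApp_resT N M x (i.unop.le : V.unop.1 ≤ U.unop.1) V.unop.2 q }

/-- **`TStalk N M x → N_x ⊗ M_x`, `germ_U(n ⊗ m) ↦ germ_U n ⊗ germ_U m`** (as an additive map; linearity below).
[cite: StacksProject, Tag 01CA (Lemma 17.16.1)] -/
def toTensorFun : TStalk N M x →+ MStalk x N ⊗[X.presheaf.stalk x] MStalk x M :=
  (colimit.desc ((OpenNhds.inclusion x).op ⋙ tensorPresheafAb N M) (toTensorCocone N M x)).hom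

/-- Value on the germ of any section. [cite: StacksProject, Tag 01CA (Lemma 17.16.1)] -/
theorem toTensorFun_tgerm (U : X.Opens) (hx : x ∈ U) (q : TSec N M U) :
    toTensorFun N M x (tgerm N M x U hx q) = toTensorCoconeApp N M x U hx q := by
  change (colimit.desc _ (toTensorCocone N M x))
    (colimit.ι ((OpenNhds.inclusion x).op ⋙ tensorPresheafAb N M) (op ⟨U, hx⟩) q) = _
  rw [colimit.ι_desc_apply]
  rfl

/-- Value on the germ of a pure tensor. [cite: StacksProject, Tag 01CA (Lemma 17.16.1)] -/
theorem toTensorFun_tgerm_tmul (U : X.Opens) (hx : x ∈ U) (n : secMod N U) (m : secMod M U) :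
    toTensorFun N M x (tgerm N M x U hx (n ⊗ₜ m)) = stalkGerm x N U hx n ⊗ₜ[X.presheaf.stalk x] stalkGerm x M U hx m := by
  rw [toTensorFun_tgerm, toTensorCoconeApp_tmul]

/-- `toTensorFun` is `𝒪_{X,x}`-linear. [cite: StacksProject, Tag 01CA (Lemma 17.16.1)] -/
theorem toTensorFun_smul (r : X.presheaf.stalk x) (t : TStalk N M x) :
    toTensorFun N M x (r • t) = r • toTensorFun N M x t := by
  obtain ⟨U, hxU, r, rfl⟩ := X.presheaf.exists_germ_eq r
  obtain ⟨V, hxV, q, rfl⟩ := exists_tgerm_eq N M x t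
  have hxW : x ∈ U ⊓ V := ⟨hxU, hxV⟩
  -- move both to `U ⊓ V`
  rw [← X.presheaf.germ_res_apply (homOfLE inf_le_left : U ⊓ V ⟶ U) x hxW, ← tgerm_resT N M x (inf_le_right : U ⊓ V ≤ V) hxW,
    ← tgerm_smul]
  generalize X.presheaf.map (homOfLE inf_le_left : U ⊓ V ⟶ U).op r = r'
  generalize resT N M (inf_le_right : U ⊓ V ≤ V) q = q'
  induction q' using TensorProduct.induction_on with
  | zero => rw [smul_zero, tgerm_zero, map_zero, smul_zero]
  | tmul n m =>
    rw [TensorProduct.smul_tmul', toTensorFun_tgerm_tmul, toTensorFun_tgerm_tmul, TensorProduct.smul_tmul']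
    congr 1
    exact germ_smul x N (U ⊓ V) hxW r' n
  | add a b ha hb => rw [smul_add, tgerm_add, map_add, ha, hb, tgerm_add, map_add, smul_add]

/-- **`TStalk N M x →ₗ[𝒪_{X,x}] N_x ⊗ M_x`.** [cite: StacksProject, Tag 01CA (Lemma 17.16.1)] -/
def toTensor : TStalk N M x →ₗ[X.presheaf.stalk x] MStalk x N ⊗[X.presheaf.stalk x] MStalk x M where
  toFun := toTensorFun N M x
  map_add' := map_add _
  map_smul' := toTensorFun_smul N M x

/-- For `n ∈ N(U)` and `m ∈ M(V)`: `germ_{U ∩ V}(n| ⊗ m|)`. [cite: StacksProject, Tag 01CA (Lemma 17.16.1)] -/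
def tgermPair (U : X.Opens) (hxU : x ∈ U) (n : secMod N U) (V : X.Opens) (hxV : x ∈ V) (m : secMod M V) : TStalk N M x :=
  tgerm N M x (U ⊓ V) (Opens.mem_inf.mpr ⟨hxU, hxV⟩) (res N inf_le_left n ⊗ₜ res M inf_le_right m)

/-- `tgermPair` over the same open is the germ of the pure tensor. [cite: StacksProject, Tag 01CA] -/
theorem tgermPair_self (U : X.Opens) (hxU : x ∈ U) (n : secMod N U) (m : secMod M U) :
    tgermPair N M x U hxU n U hxU m = tgerm N M x U hxU (n ⊗ₜ m) := by
  rw [tgermPair, ← resT_tmul, tgerm_resT]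

/-- `tgermPair` is unchanged by restricting `m`. [cite: StacksProject, Tag 01CA] -/
theorem tgermPair_res_right (U : X.Opens) (hxU : x ∈ U) (n : secMod N U) {V W : X.Opens} (hW : W ≤ V) (hxW : x ∈ W) (m : secMod M V) :
    tgermPair N M x U hxU n W hxW (res M hW m) = tgermPair N M x U hxU n V (hW hxW) m := by
  rw [tgermPair, tgermPair, res_res, ← tgerm_resT N M x (inf_le_inf_left U hW : U ⊓ W ≤ U ⊓ V) ⟨hxU, hxW⟩, resT_tmul, res_res, res_res]

/-- `tgermPair` is unchanged by restricting `n`. [cite: StacksProject, Tag 01CA] -/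
theorem tgermPair_res_left {U U' : X.Opens} (hU' : U' ≤ U) (hxU' : x ∈ U') (n : secMod N U) (V : X.Opens) (hxV : x ∈ V) (m : secMod M V) :
    tgermPair N M x U' hxU' (res N hU' n) V hxV m = tgermPair N M x U (hU' hxU') n V hxV m := by
  rw [tgermPair, tgermPair, res_res, ← tgerm_resT N M x (inf_le_inf_right V hU' : U' ⊓ V ≤ U ⊓ V) ⟨hxU', hxV⟩, resT_tmul, res_res,
    res_res]

/-- `tgermPair` is additive in `m`. [cite: StacksProject, Tag 01CA] -/
theorem tgermPair_add_right (U : X.Opens) (hxU : x ∈ U) (n : secMod N U) (V : X.Opens) (hxV : x ∈ V) (m m' : secMod M V) :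
    tgermPair N M x U hxU n V hxV (m + m') = tgermPair N M x U hxU n V hxV m + tgermPair N M x U hxU n V hxV m' := by
  rw [tgermPair, tgermPair, tgermPair, res_add, TensorProduct.tmul_add, tgerm_add]

/-- `tgermPair` is additive in `n`. [cite: StacksProject, Tag 01CA] -/
theorem tgermPair_add_left (U : X.Opens) (hxU : x ∈ U) (n n' : secMod N U) (V : X.Opens) (hxV : x ∈ V) (m : secMod M V) :
    tgermPair N M x U hxU (n + n') V hxV m = tgermPair N M x U hxU n V hxV m + tgermPair N M x U hxU n' V hxV m := by
  rw [tgermPair, tgermPair, tgermPair, res_add, TensorProduct.add_tmul, tgerm_add]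

/-- `tgermPair n 0 = 0`. [cite: StacksProject, Tag 01CA] -/
theorem tgermPair_zero_right (U : X.Opens) (hxU : x ∈ U) (n : secMod N U) (V : X.Opens) (hxV : x ∈ V) :
    tgermPair N M x U hxU n V hxV 0 = 0 := by
  rw [tgermPair, res_zero, TensorProduct.tmul_zero, tgerm_zero]

/-- `tgermPair 0 m = 0`. [cite: StacksProject, Tag 01CA] -/
theorem tgermPair_zero_left (U : X.Opens) (hxU : x ∈ U) (V : X.Opens) (hxV : x ∈ V) (m : secMod M V) :
    tgermPair N M x U hxU 0 V hxV m = 0 := by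
  rw [tgermPair, res_zero, TensorProduct.zero_tmul, tgerm_zero]

/-- `tgermPair n (r • m) = germ r • tgermPair n m`. [cite: StacksProject, Tag 01CA] -/
theorem tgermPair_smul_right (U : X.Opens) (hxU : x ∈ U) (n : secMod N U) (V : X.Opens) (hxV : x ∈ V) (r : secRing X V) (m : secMod M V) :
    tgermPair N M x U hxU n V hxV (r • m) = X.presheaf.germ V x hxV r • tgermPair N M x U hxU n V hxV m := by
  rw [tgermPair, tgermPair, res_smul, TensorProduct.tmul_smul, tgerm_smul]
  congr 1
  exact X.presheaf.germ_res_apply (homOfLE inf_le_right) x _ r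

/-- `tgermPair (r • n) m = germ r • tgermPair n m`. [cite: StacksProject, Tag 01CA] -/
theorem tgermPair_smul_left (U : X.Opens) (hxU : x ∈ U) (r : secRing X U) (n : secMod N U) (V : X.Opens) (hxV : x ∈ V) (m : secMod M V) :
    tgermPair N M x U hxU (r • n) V hxV m = X.presheaf.germ U x hxU r • tgermPair N M x U hxU n V hxV m := by
  rw [tgermPair, tgermPair, res_smul, ← TensorProduct.smul_tmul', tgerm_smul]
  congr 1
  exact X.presheaf.germ_res_apply (homOfLE inf_le_left) x _ r

end PresheafStalk

end Literature.AlgebraicGeometry.Modules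

end
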